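import Literature.AlgebraicGeometry.Motives.UniversalHypersurfaceRegularLocusEquation
import Literature.AlgebraicGeometry.Motives.ComplexPointsRegularInjectiveChart
import HarnessLib

/-!
# The regular coordinates `(b', z/zᵢ)` are `C^∞` charts of the complex manifold `𝒴°(ℂ)`

Family `hodge`, layer `Literature/AlgebraicGeometry/Motives`; sequel of `UniversalHypersurfaceRegularLocusCoordinates` /
`…Equation` (coefficients `regCoeff`, homogeneous coordinates `hypersurfacePoint (regularToProjectiveSpace ℂ n d)`, their
regularity, injectivity of `(b, [z])`, and the equation `Σ_m b_m z^m = 0` on the regular locus `𝒴° = regularTotal ℂ n d` of the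
universal hypersurface) and of `ComplexPointsRegularInjectiveChart` (injective families of regular functions are `C^∞` charts of
`X(ℂ)`, Clements–Osgood). On the open piece `𝒴°(ℂ)ᵢ = {zᵢ ≠ 0}`:

* `regChartFun n d i : 𝒴°(ℂ) → ℂ^{ {m ≠ xᵢ^d} ⊕ Fin (n+1)}`, `Q ↦ ((b_m(Q))_{m ≠ xᵢ^d}, (z_k/zᵢ)_{k ≠ i})` — all coefficients but
  that of `xᵢ^d`, and the affine coordinates of the `i`-th chart;
* `regular_regChartFun` — its components are regular functions on `𝒴°ᵢ`; `isOpen_regChartDom`;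
* `injOn_regChartFun` — **it is injective on `𝒴°(ℂ)ᵢ`**: the missing coefficient is recovered from the equation,
  `b_{xᵢ^d} = −Σ_{m ≠ xᵢ^d} b_m z^m / zᵢ^d`, and `(b, [z])` determines the point;
* `card_regChartIndex` — the number of coordinates is `n + #{monomials} = dim 𝒴°`;
* `exists_regChart` — hence (`ComplexPoints.exists_openPartialHomeomorph_of_regular_injOn`) **`regChartFun n d i` restricted to
  `𝒴°(ℂ)ᵢ` is an open partial homeomorphism onto an open subset of `ℂ^{n+N}`, `C^∞` with `C^∞` inverse** for the real manifold
  structure `ComplexPoints.chartedSpace (regularTotal ℂ n d) (n + N)`, and `bijective_mfderiv_regChartFun` — its differential is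
  bijective at every point of `𝒴°(ℂ)ᵢ`.

These are the explicit charts of the ambient manifold of the degeneration to a nodal hypersurface used by the programme discharging
`HodgeTheory/CyclicCoverNodalMeridianLocalMonodromyBound` (in the chart `i = 2` of `𝒴°(ℂ)` for `(n, d) = (2, p)` the pencil
`x₃^p = f₁ + c x₂^p` reads `c = −φ(y)`, `φ = y₃^p − f₁(y₀, y₁, 1)`). Everything is proved; the definitions are the three concrete ones
(`regPowIndex`, `regChartDom`, `regChartFun`); no named facts.

## References

* [SerreGAGA1956] J.-P. Serre, Géométrie algébrique et géométrie analytique, Ann. Inst. Fourier 6 (1956), §2 n°5–6.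
* [FritzscheGrauert2002] K. Fritzsche, H. Grauert, From Holomorphic Functions to Complex Manifolds (2002), Ch. I §8 Thm. 8.5.
* [VoisinHodgeII2003] C. Voisin, Hodge Theory and Complex Algebraic Geometry II (2003), §6.2.1, §2.3.
-/

noncomputable section

open CategoryTheory AlgebraicGeometry MvPolynomial TopologicalSpace Set
open scoped Manifold ContDiff
open Literature.AlgebraicGeometry.HodgeTheory Literature.NumberTheory.Transcendental

universe u

namespace Literature.AlgebraicGeometry.Motives.UniversalHypersurface

variable (n d : ℕ) (i : Fin (n + 2))

/-! ### The chart functions -/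

/-- The index `xᵢ^d` of the monomial whose coefficient is solved for on the chart `{zᵢ ≠ 0}`. [cite: VoisinHodgeII2003, §6.2.1] -/
def regPowIndex : DegIndex n d := ⟨Finsupp.single i d, by simp [Finsupp.degree_single]⟩

/-- The chart domain `𝒴°(ℂ)ᵢ = {Q | zᵢ(Q) ≠ 0}`: the complex points over `ι⁻¹(D₊(xᵢ))`. [cite: SerreGAGA1956, §2 n°5 Prop. 2] -/
def regChartDom : Set (ComplexPoints (regularTotal ℂ n d)) :=
  {Q | Q.pt ∈ (regularToProjectiveSpace ℂ n d).left ⁻¹ᵁ projChartOpen i}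

/-- `𝒴°(ℂ)ᵢ` is the preimage of the chart domain `Uᵢ ⊆ ℙ(ℂⁿ⁺²)`. [cite: SerreGAGA1956, §2 n°5 Prop. 2] -/
theorem regChartDom_eq_preimage :
    regChartDom n d i =
      hypersurfacePoint (regularToProjectiveSpace ℂ n d) ⁻¹' (Projectivization.stdChart i).source :=
  setOf_pt_mem_preimage_projChartOpen _ i

/-- `𝒴°(ℂ)ᵢ` is open. [cite: SerreGAGA1956, §2 n°5] -/
theorem isOpen_regChartDom : IsOpen (regChartDom n d i) :=
  AlgPoints.isOpen_setOf_pt_mem _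

/-- **The chart functions** `Q ↦ ((b_m(Q))_{m ≠ xᵢ^d}, (z_{i.succAbove j}(Q)/zᵢ(Q))_j)`. [cite: VoisinHodgeII2003, §6.2.1]
[cite: SerreGAGA1956, §2 n°5] -/
def regChartFun (Q : ComplexPoints (regularTotal ℂ n d)) :
    ({m : DegIndex n d // m ≠ regPowIndex n d i} ⊕ Fin (n + 1)) → ℂ :=
  Sum.elim (fun m => regCoeff ℂ n d Q m.1)
    (fun j => Projectivization.stdChart i (hypersurfacePoint (regularToProjectiveSpace ℂ n d) Q) j)

/-- The number of chart coordinates is `n + N = dim 𝒴°`, `N = #{monomials of degree d}`. [cite: VoisinHodgeII2003, §6.2.1] -/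
theorem card_regChartIndex :
    Fintype.card ({m : DegIndex n d // m ≠ regPowIndex n d i} ⊕ Fin (n + 1)) = n + Fintype.card (DegIndex n d) := by
  classical
  rw [Fintype.card_sum, Fintype.card_fin, Fintype.card_subtype_compl, Fintype.card_subtype_eq]
  have h1 : 1 ≤ Fintype.card (DegIndex n d) := Fintype.card_pos_iff.mpr ⟨regPowIndex n d i⟩
  omega

/-- **The chart functions are regular on `𝒴°(ℂ)ᵢ`**: the coefficients are the global functions `π^* a_m`, the affine
coordinates are the functions `ι^*(x_k/xᵢ)` on `ι⁻¹(D₊(xᵢ))`. [cite: SerreGAGA1956, §2 n°5 Lemme 1 c), Prop. 2] -/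
theorem regular_regChartFun (t : {m : DegIndex n d // m ≠ regPowIndex n d i} ⊕ Fin (n + 1)) :
    ∃ (U : (regularTotal ℂ n d).left.Opens) (s : Γ((regularTotal ℂ n d).left, U)),
      regChartDom n d i ⊆ {Q | Q.pt ∈ U} ∧ ∀ Q ∈ regChartDom n d i, regChartFun n d i Q t = AlgPoints.evalOrZero U s Q := by
  rcases t with m | j
  · exact ⟨(regularFamily ℂ n d).left ⁻¹ᵁ ⊤, regCoeffFn ℂ n d m.1, fun _ _ => trivial,
      fun Q _ => regCoeff_eq_evalOrZero ℂ n d Q m.1⟩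
  · exact ⟨(regularToProjectiveSpace ℂ n d).left ⁻¹ᵁ projChartOpen i,
      (regularToProjectiveSpace ℂ n d).left.app (projChartOpen i) (projRatioSection i (i.succAbove j)),
      fun Q hQ => hQ, fun Q hQ => (evalOrZero_app_projRatioSection _ i j Q hQ).symm⟩

/-! ### Injectivity: the missing coefficient is recovered from the equation -/

/-- `Σ_m a_m z^m` written out: `eval z (formOfCoeffs a) = Σ_m a_m · Π_k z_k^{m_k}`. [cite: VoisinHodgeII2003, §6.2.1] -/
theorem eval_formOfCoeffs (a : DegIndex n d → ℂ) (z : Fin (n + 2) → ℂ) :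
    MvPolynomial.eval z (formOfCoeffs a) = ∑ m : DegIndex n d, a m * m.1.prod fun k e => z k ^ e := by
  rw [formOfCoeffs_def, map_sum]
  refine Finset.sum_congr rfl fun m _ => ?_
  rw [MvPolynomial.eval_monomial]

/-- The monomial `xᵢ^d` evaluates to `zᵢ^d` (Mathlib `Finsupp.prod_single_index`). [cite: VoisinHodgeII2003, §6.2.1] -/
theorem prod_regPowIndex (z : Fin (n + 2) → ℂ) :
    ((regPowIndex n d i).1.prod fun k e => z k ^ e) = z i ^ d := by
  rw [regPowIndex, Finsupp.prod_single_index (by simp)]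

/-- **The coefficient of `xᵢ^d` is determined by the others and a zero `z` with `zᵢ ≠ 0`**: if `Σ_m a_m z^m = 0 = Σ_m a'_m z^m`
and `a_m = a'_m` for `m ≠ xᵢ^d`, then `a = a'`. [cite: VoisinHodgeII2003, §6.2.1] -/
theorem eq_of_eval_formOfCoeffs_eq_zero {a a' : DegIndex n d → ℂ} {z : Fin (n + 2) → ℂ} (hz : z i ≠ 0)
    (ha : MvPolynomial.eval z (formOfCoeffs a) = 0) (ha' : MvPolynomial.eval z (formOfCoeffs a') = 0)
    (h : ∀ m, m ≠ regPowIndex n d i → a m = a' m) : a = a' := by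
  classical
  funext m
  by_cases hm : m = regPowIndex n d i
  · subst hm
    rw [eval_formOfCoeffs, ← Finset.add_sum_erase _ _ (Finset.mem_univ (regPowIndex n d i))] at ha ha'
    have hrest : (∑ m ∈ Finset.univ.erase (regPowIndex n d i), a m * m.1.prod fun k e => z k ^ e) =
        ∑ m ∈ Finset.univ.erase (regPowIndex n d i), a' m * m.1.prod fun k e => z k ^ e :=
      Finset.sum_congr rfl fun m hm => by rw [h m (Finset.ne_of_mem_erase hm)]
    rw [hrest] at ha
    have hmul : a (regPowIndex n d i) * (regPowIndex n d i).1.prod (fun k e => z k ^ e) =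
        a' (regPowIndex n d i) * (regPowIndex n d i).1.prod (fun k e => z k ^ e) := by
      linear_combination ha - ha'
    rw [prod_regPowIndex] at hmul
    exact mul_right_cancel₀ (pow_ne_zero d hz) hmul
  · exact h m hm

/-- **The chart functions are injective on `𝒴°(ℂ)ᵢ`.** Equal affine coordinates in `Uᵢ` give equal homogeneous coordinates;
equal coefficients off `xᵢ^d` and the equation `Σ_m b_m z^m = 0` (`eval_rep_formOfCoeffs_regCoeff`) give equal coefficient
vectors; and `(b, [z])` determines the point (`eq_of_hypersurfacePoint_eq_of_regCoeff_eq`).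
[cite: VoisinHodgeII2003, §6.2.1] [cite: SerreGAGA1956, §2 n°5] -/
theorem injOn_regChartFun : InjOn (regChartFun n d i) (regChartDom n d i) := by
  intro Q hQ Q' hQ' h
  rw [regChartDom_eq_preimage] at hQ hQ'
  have hz : hypersurfacePoint (regularToProjectiveSpace ℂ n d) Q =
      hypersurfacePoint (regularToProjectiveSpace ℂ n d) Q' := by
    refine (Projectivization.stdChart i).injOn hQ hQ' ?_
    funext j
    exact congrFun h (Sum.inr j)
  refine eq_of_hypersurfacePoint_eq_of_regCoeff_eq n d hz ?_
  have hzi : (hypersurfacePoint (regularToProjectiveSpace ℂ n d) Q).rep i ≠ 0 := by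
    have hsrc := hQ
    rw [Set.mem_preimage, Projectivization.stdChart_source] at hsrc
    exact hsrc
  refine eq_of_eval_formOfCoeffs_eq_zero n d i hzi (eval_rep_formOfCoeffs_regCoeff n d Q) ?_ fun m hm => ?_
  · rw [hz]; exact eval_rep_formOfCoeffs_regCoeff n d Q'
  · exact congrFun h (Sum.inl ⟨m, hm⟩)

/-! ### The chart -/

/-- **`regChartFun n d i` is a `C^∞` chart of `𝒴°(ℂ)` on `𝒴°(ℂ)ᵢ` with `C^∞` inverse** (`d ≥ 1`, `𝒴°(ℂ)ᵢ ≠ ∅`): an open partial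
homeomorphism `Φ` with `⇑Φ = regChartFun n d i`, source `𝒴°(ℂ)ᵢ`, target the open set `regChartFun(𝒴°(ℂ)ᵢ)`, `C^∞` on the source and
with `C^∞` inverse on the target, for `ComplexPoints.chartedSpace (regularTotal ℂ n d) (n + N)`.
[cite: SerreGAGA1956, §2 n°6] [cite: FritzscheGrauert2002, Ch. I §8 Thm. 8.5] -/
theorem exists_regChart (hd : 0 < d) (hne : (regChartDom n d i).Nonempty) :
    haveI := locallyOfFiniteType_regularTotal_hom ℂ n d hd
    haveI := smoothOfRelativeDimension_regularTotal_hom ℂ n d hd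
    letI := ComplexPoints.chartedSpace (regularTotal ℂ n d) (n + Fintype.card (DegIndex n d))
    ∃ Φ : OpenPartialHomeomorph (ComplexPoints (regularTotal ℂ n d))
        (({m : DegIndex n d // m ≠ regPowIndex n d i} ⊕ Fin (n + 1)) → ℂ),
      ⇑Φ = regChartFun n d i ∧ Φ.source = regChartDom n d i ∧ Φ.target = regChartFun n d i '' regChartDom n d i ∧
      ContMDiffOn (𝓡 (2 * (n + Fintype.card (DegIndex n d))))
        𝓘(ℝ, ({m : DegIndex n d // m ≠ regPowIndex n d i} ⊕ Fin (n + 1)) → ℂ) ∞ Φ (regChartDom n d i) ∧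
      ContMDiffOn 𝓘(ℝ, ({m : DegIndex n d // m ≠ regPowIndex n d i} ⊕ Fin (n + 1)) → ℂ)
        (𝓡 (2 * (n + Fintype.card (DegIndex n d)))) ∞ Φ.symm (regChartFun n d i '' regChartDom n d i) := by
  haveI := locallyOfFiniteType_regularTotal_hom ℂ n d hd
  haveI := smoothOfRelativeDimension_regularTotal_hom ℂ n d hd
  exact ComplexPoints.exists_openPartialHomeomorph_of_regular_injOn (isOpen_regChartDom n d i) hne
    (card_regChartIndex n d i) (regular_regChartFun n d i) (injOn_regChartFun n d i)

/-- **The differential of the chart functions is bijective** at every point of `𝒴°(ℂ)ᵢ` (`d ≥ 1`).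
[cite: FritzscheGrauert2002, Ch. I §8 Thm. 8.5] [cite: SerreGAGA1956, §2 n°6] -/
theorem bijective_mfderiv_regChartFun (hd : 0 < d) {Q : ComplexPoints (regularTotal ℂ n d)}
    (hQ : Q ∈ regChartDom n d i) :
    haveI := locallyOfFiniteType_regularTotal_hom ℂ n d hd
    haveI := smoothOfRelativeDimension_regularTotal_hom ℂ n d hd
    letI := ComplexPoints.chartedSpace (regularTotal ℂ n d) (n + Fintype.card (DegIndex n d))
    Function.Bijective (mfderiv (𝓡 (2 * (n + Fintype.card (DegIndex n d))))
      𝓘(ℝ, ({m : DegIndex n d // m ≠ regPowIndex n d i} ⊕ Fin (n + 1)) → ℂ) (regChartFun n d i) Q) := by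
  haveI := locallyOfFiniteType_regularTotal_hom ℂ n d hd
  haveI := smoothOfRelativeDimension_regularTotal_hom ℂ n d hd
  exact ComplexPoints.bijective_mfderiv_of_regular_injOn (isOpen_regChartDom n d i) (card_regChartIndex n d i)
    (regular_regChartFun n d i) (injOn_regChartFun n d i) hQ

/-- The image `regChartFun(𝒴°(ℂ)ᵢ)` is open (`d ≥ 1`). [cite: FritzscheGrauert2002, Ch. I §8 Cor. 8.6] -/
theorem isOpen_image_regChartFun (hd : 0 < d) : IsOpen (regChartFun n d i '' regChartDom n d i) := by
  haveI := locallyOfFiniteType_regularTotal_hom ℂ n d hd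
  haveI := smoothOfRelativeDimension_regularTotal_hom ℂ n d hd
  exact ComplexPoints.isOpen_image_of_regular_injOn (isOpen_regChartDom n d i) (card_regChartIndex n d i)
    (regular_regChartFun n d i) (injOn_regChartFun n d i)

/-- The chart functions are `C^∞` at the points of `𝒴°(ℂ)ᵢ` (`d ≥ 1`). [cite: SerreGAGA1956, §2 n°6] -/
theorem contMDiffAt_regChartFun (hd : 0 < d) {Q : ComplexPoints (regularTotal ℂ n d)} (hQ : Q ∈ regChartDom n d i) :
    haveI := locallyOfFiniteType_regularTotal_hom ℂ n d hd
    haveI := smoothOfRelativeDimension_regularTotal_hom ℂ n d hd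
    letI := ComplexPoints.chartedSpace (regularTotal ℂ n d) (n + Fintype.card (DegIndex n d))
    ContMDiffAt (𝓡 (2 * (n + Fintype.card (DegIndex n d))))
      𝓘(ℝ, ({m : DegIndex n d // m ≠ regPowIndex n d i} ⊕ Fin (n + 1)) → ℂ) ∞ (regChartFun n d i) Q := by
  haveI := locallyOfFiniteType_regularTotal_hom ℂ n d hd
  haveI := smoothOfRelativeDimension_regularTotal_hom ℂ n d hd
  exact ComplexPoints.contMDiffAt_of_regular (e := n + Fintype.card (DegIndex n d)) (isOpen_regChartDom n d i)
    (regular_regChartFun n d i) hQ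

end Literature.AlgebraicGeometry.Motives.UniversalHypersurface

end
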